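import Mathlib.Analysis.SpecialFunctions.Pow.Integral
import Mathlib.Analysis.SpecialFunctions.ImproperIntegrals
import Mathlib.Analysis.SpecialFunctions.Integrability.Basic
import Literature.Analysis.FunctionSpaces.WeakLpLocal
import HarnessLib

/-!
# Weak `L^p` splits at height one: `L^{p,∞} ⊂ L^r + (L^q ∩ L^∞)` (`r < p < q`)

Analysis/FunctionSpaces proofs file (no new definitions) over `WeakLp.lean`
(`Literature.Analysis.FunctionSpaces.MemWeakLp`, Grafakos Def. 1.1.5). The classical truncation
of a weak-`L^p` function at height `1`: with `A = {‖f‖ > 1}`,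

* the high part `f 𝟙_A` lies in `L^r(μ)` for every `0 < r < p`
  (`MemWeakLp.memLp_indicator_one_lt_norm`): by the layer-cake formula,
  `∫ |f 𝟙_A|^r = r∫₀^∞ s^{r−1} μ{|f 𝟙_A| > s} ds ≤ r∫₀¹ s^{r−1} μ(A) ds + r∫₁^∞ s^{r−1−p}‖f‖^p_{p,∞} ds`
  and `μ(A) ≤ ‖f‖^p_{p,∞}`;
* the low part `f 𝟙_{Aᶜ}` is bounded by `1` and lies in `L^q(μ)` for every `p < q < ∞`
  (`MemWeakLp.memLp_indicator_norm_le_one`): `∫ |f 𝟙_{Aᶜ}|^q ≤ q∫₀¹ s^{q−1−p} ‖f‖^p_{p,∞} ds`.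

This is Grafakos, *Classical Fourier Analysis*, 3rd ed., §1.1, Exercise 1.1.10 / the proof of
the Marcinkiewicz interpolation theorem (Thm 1.3.2: "`f = f₀ + f₁`, `f₀ = f` on `{|f| > δα}`,
… `f₀ ∈ L^{p₀}`, `f₁ ∈ L^{p₁}`"), and the standing decomposition `L³_w ⊂ L² + L^q` (`q > 3`) of
the forward self-similar Navier–Stokes theory (Bradshaw–Tsai 2017, §1: `L³_w ⊂ L²_uloc`; used in
the discharge of `Literature.Analysis.FluidPDE.bradshawTsai2017_caloric_localLeray`). The
statements assume `f` strongly measurable (so that `A` is measurable); the general case follows by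
passing to a representative (`MemWeakLp.congr_ae`).

* `eWeakLpPow_congr_ae`, `MemWeakLp.congr_ae` — the weak quasinorm only sees `f` up to null sets.
* `MemWeakLp.memLp_indicator_one_lt_norm`, `MemWeakLp.integrable_indicator_one_lt_norm`,
  `MemWeakLp.memLp_indicator_norm_le_one`, `norm_indicator_norm_le_one_le`.

## References

* L. Grafakos, *Classical Fourier Analysis*, 3rd ed., GTM 249 (2014), §1.1 (Def. 1.1.5,
  Prop. 1.1.6), Thm 1.3.2 (proof).
* Z. Bradshaw, T.-P. Tsai, Ann. Henri Poincaré 18 (2017) 1095–1119, §1 [BradshawTsai2017AHP].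
-/

noncomputable section

open MeasureTheory Set Filter Topology
open scoped ENNReal NNReal

namespace Literature.Analysis.FunctionSpaces

variable {α : Type*} [MeasurableSpace α] {E : Type*} [NormedAddCommGroup E]
variable {f g : α → E} {p : ℝ≥0∞} {μ : Measure α}

/-! ### A.e.-invariance of the weak quasinorm -/

/-- The weak quasinorm only depends on the a.e.-class of `f`. [folklore] -/
theorem eWeakLpPow_congr_ae (hfg : f =ᵐ[μ] g) : eWeakLpPow f p μ = eWeakLpPow g p μ := by
  unfold eWeakLpPow
  refine iSup_congr fun t => ?_
  rw [measure_congr (show {x | (t : ℝ≥0∞) < ‖f x‖ₑ} =ᵐ[μ] {x | (t : ℝ≥0∞) < ‖g x‖ₑ} from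
    hfg.mono fun x hx => by
      show ((t : ℝ≥0∞) < ‖f x‖ₑ) = ((t : ℝ≥0∞) < ‖g x‖ₑ)
      rw [hx])]

/-- Weak-`L^p` membership is invariant under a.e.-modification. [folklore] -/
theorem MemWeakLp.congr_ae (hf : MemWeakLp f p μ) (hfg : f =ᵐ[μ] g) : MemWeakLp g p μ :=
  ⟨hf.1.congr hfg, (eWeakLpPow_congr_ae hfg) ▸ hf.2⟩

/-! ### The two layer-cake tails -/

/-- `∫₀¹ s^{a} ds < ∞` in `ℝ≥0∞` form for `-1 < a`. [folklore] -/
theorem lintegral_Ioc_zero_one_ofReal_rpow_lt_top {a : ℝ} (ha : -1 < a) :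
    ∫⁻ t in Ioc (0 : ℝ) 1, ENNReal.ofReal (t ^ a) < ∞ := by
  have hint : IntegrableOn (fun t : ℝ => t ^ a) (Ioc 0 1) volume :=
    (intervalIntegral.intervalIntegrable_rpow' (a := 0) (b := 1) ha).1
  exact lt_of_le_of_lt (lintegral_mono fun t => Real.ofReal_le_enorm _) hint.2

/-- `∫₁^∞ s^{a} ds < ∞` in `ℝ≥0∞` form for `a < -1`. [folklore] -/
theorem lintegral_Ioi_one_ofReal_rpow_lt_top {a : ℝ} (ha : a < -1) :
    ∫⁻ t in Ioi (1 : ℝ), ENNReal.ofReal (t ^ a) < ∞ := by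
  have hint : IntegrableOn (fun t : ℝ => t ^ a) (Ioi 1) volume :=
    integrableOn_Ioi_rpow_of_lt ha zero_lt_one
  exact lt_of_le_of_lt (lintegral_mono fun t => Real.ofReal_le_enorm _) hint.2

/-- The layer-cake integral of a function whose distribution function is bounded by `C₁` on
`(0,1]` (with weight `s^{a}`, `-1 < a`) and by `C₂ s^{b-a}`-type tails on `(1,∞)` is finite:
if `μ{s < F} s^{r-1} ≤ 𝟙_{(0,1]} C₁ s^{a} + 𝟙_{(1,∞)} C₂ s^{b}` with `-1 < a`, `b < -1` and
`C₁, C₂ < ∞`, then `∫₀^∞ μ{s < F} s^{r-1} ds < ∞`. [folklore] -/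
theorem lintegral_Ioi_meas_mul_lt_top_of_le {Φ : ℝ → ℝ≥0∞} {C₁ C₂ : ℝ≥0∞} (hC₁ : C₁ ≠ ∞)
    (hC₂ : C₂ ≠ ∞) {a b : ℝ} (ha : -1 < a) (hb : b < -1)
    (hΦ : ∀ t ∈ Ioi (0 : ℝ), Φ t ≤ (Ioc (0 : ℝ) 1).indicator (fun t => C₁ * ENNReal.ofReal (t ^ a)) t +
      (Ioi (1 : ℝ)).indicator (fun t => C₂ * ENNReal.ofReal (t ^ b)) t) :
    ∫⁻ t in Ioi (0 : ℝ), Φ t < ∞ := by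
  have hg₁m : Measurable ((Ioc (0 : ℝ) 1).indicator fun t => C₁ * ENNReal.ofReal (t ^ a)) :=
    (measurable_const.mul (by fun_prop)).indicator measurableSet_Ioc
  calc ∫⁻ t in Ioi (0 : ℝ), Φ t
      ≤ ∫⁻ t in Ioi (0 : ℝ), (Ioc (0 : ℝ) 1).indicator (fun t => C₁ * ENNReal.ofReal (t ^ a)) t +
          (Ioi (1 : ℝ)).indicator (fun t => C₂ * ENNReal.ofReal (t ^ b)) t :=
        setLIntegral_mono' measurableSet_Ioi hΦ
    _ = (∫⁻ t in Ioc (0 : ℝ) 1, C₁ * ENNReal.ofReal (t ^ a)) +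
          ∫⁻ t in Ioi (1 : ℝ), C₂ * ENNReal.ofReal (t ^ b) := by
        rw [lintegral_add_left hg₁m, lintegral_indicator measurableSet_Ioc,
          lintegral_indicator measurableSet_Ioi, Measure.restrict_restrict measurableSet_Ioc,
          Measure.restrict_restrict measurableSet_Ioi,
          inter_eq_left.2 (Ioc_subset_Ioi_self : Ioc (0 : ℝ) 1 ⊆ Ioi 0),
          inter_eq_left.2 (Ioi_subset_Ioi zero_le_one : Ioi (1 : ℝ) ⊆ Ioi 0)]
    _ = C₁ * (∫⁻ t in Ioc (0 : ℝ) 1, ENNReal.ofReal (t ^ a)) +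
          C₂ * ∫⁻ t in Ioi (1 : ℝ), ENNReal.ofReal (t ^ b) := by
        rw [lintegral_const_mul' _ _ hC₁, lintegral_const_mul' _ _ hC₂]
    _ < ∞ := ENNReal.add_lt_top.2
        ⟨ENNReal.mul_lt_top hC₁.lt_top (lintegral_Ioc_zero_one_ofReal_rpow_lt_top ha),
          ENNReal.mul_lt_top hC₂.lt_top (lintegral_Ioi_one_ofReal_rpow_lt_top hb)⟩

/-! ### The high part `f 𝟙_{‖f‖ > 1}` -/

/-- The superlevel set `{‖f‖ > 1}` of a weak-`L^p` function has finite measure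
`μ{‖f‖ > 1} ≤ ‖f‖^p_{p,∞}`. [folklore] -/
theorem MemWeakLp.meas_one_lt_norm_le (f : α → E) (p : ℝ≥0∞) (μ : Measure α) :
    μ {x | 1 < ‖f x‖} ≤ eWeakLpPow f p μ := by
  have h := ofReal_rpow_mul_meas_lt_le_eWeakLpPow f p μ zero_lt_one
  rwa [Real.one_rpow, ENNReal.ofReal_one, one_mul] at h

/-- **The high part of a weak-`L^p` function is in `L^r` for `r < p`**: for `f ∈ L^{p,∞}(μ)`
strongly measurable, `p < ∞`, and `0 < r < p`, the truncation `f 𝟙_{‖f‖ > 1}` lies in `L^r(μ)`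
(Grafakos, proof of Thm 1.3.2: the piece `f₀ = f 𝟙_{|f| > α}` of a weak-type function is in the
smaller Lebesgue space; layer cake `∫|f𝟙_A|^r ≤ r∫₀¹ s^{r−1}μ(A) + r∫₁^∞ s^{r−1−p}‖f‖^p_{p,∞}`). [folklore] -/
theorem MemWeakLp.memLp_indicator_one_lt_norm (hf : MemWeakLp f p μ) (hfm : StronglyMeasurable f)
    (hp : p ≠ ∞) {r : ℝ≥0∞} (hr0 : r ≠ 0) (hrp : r < p) :
    MemLp ({x | 1 < ‖f x‖}.indicator f) r μ := by
  have hr : r ≠ ∞ := (hrp.trans_le le_top).ne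
  have hrpos : 0 < r.toReal := ENNReal.toReal_pos hr0 hr
  have hrp' : r.toReal < p.toReal := (ENNReal.toReal_lt_toReal hr hp).2 hrp
  have hA : MeasurableSet {x | 1 < ‖f x‖} :=
    measurableSet_lt measurable_const hfm.norm.measurable
  set g : α → E := {x | 1 < ‖f x‖}.indicator f with hg
  set W : ℝ≥0∞ := eWeakLpPow f p μ with hW
  have hWtop : W ≠ ∞ := hf.2.ne
  have hgm : AEStronglyMeasurable g μ := hf.1.indicator hA
  refine ⟨hgm, ?_⟩
  rw [eLpNorm_lt_top_iff_lintegral_rpow_enorm_lt_top hr0 hr]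
  -- layer cake
  have hmeas : AEMeasurable (fun x => ‖g x‖) μ := hgm.norm.aemeasurable
  have hnn : 0 ≤ᵐ[μ] fun x => ‖g x‖ := Eventually.of_forall fun x => norm_nonneg _
  have hlhs : ∫⁻ x, ‖g x‖ₑ ^ r.toReal ∂μ = ∫⁻ x, ENNReal.ofReal (‖g x‖ ^ r.toReal) ∂μ :=
    lintegral_congr fun x => by
      rw [← ofReal_norm, ENNReal.ofReal_rpow_of_nonneg (norm_nonneg _) hrpos.le]
  rw [hlhs, lintegral_rpow_eq_lintegral_meas_lt_mul μ hnn hmeas hrpos]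
  refine ENNReal.mul_lt_top ENNReal.ofReal_lt_top ?_
  refine lintegral_Ioi_meas_mul_lt_top_of_le (C₁ := W) (C₂ := W) hWtop hWtop
    (a := r.toReal - 1) (b := r.toReal - 1 - p.toReal) (by linarith) (by linarith) ?_
  intro t ht
  have ht0 : 0 < t := ht
  -- the superlevel sets of `g`
  have hsubA : {a | t < ‖g a‖} ⊆ {x | 1 < ‖f x‖} := by
    intro x hx
    by_contra hxA
    have : g x = 0 := indicator_of_notMem hxA _
    rw [mem_setOf_eq, this, norm_zero] at hx
    exact absurd hx (not_lt.2 ht0.le)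
  have hsubf : {a | t < ‖g a‖} ⊆ {x | t < ‖f x‖} := by
    intro x hx
    have hxA := hsubA hx
    rw [mem_setOf_eq, hg, indicator_of_mem hxA] at hx
    exact hx
  rcases le_or_gt t 1 with h1 | h1
  · rw [indicator_of_mem (mem_Ioc.2 ⟨ht0, h1⟩)]
    refine le_add_right ?_
    refine mul_le_mul' ?_ le_rfl
    exact (measure_mono hsubA).trans (MemWeakLp.meas_one_lt_norm_le f p μ)
  · rw [indicator_of_mem (mem_Ioi.2 h1)]
    refine le_add_left ?_
    have h2 : μ {a | t < ‖g a‖} ≤ W * (ENNReal.ofReal (t ^ p.toReal))⁻¹ :=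
      (measure_mono hsubf).trans (meas_lt_norm_le_eWeakLpPow_mul_inv f p μ ht0)
    calc μ {a | t < ‖g a‖} * ENNReal.ofReal (t ^ (r.toReal - 1))
        ≤ W * (ENNReal.ofReal (t ^ p.toReal))⁻¹ * ENNReal.ofReal (t ^ (r.toReal - 1)) :=
          mul_le_mul' h2 le_rfl
      _ = W * ENNReal.ofReal (t ^ (r.toReal - 1 - p.toReal)) := by
          rw [mul_assoc, ← ENNReal.ofReal_inv_of_pos (Real.rpow_pos_of_pos ht0 _),
            ← Real.rpow_neg ht0.le, ← ENNReal.ofReal_mul (Real.rpow_nonneg ht0.le _),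
            ← Real.rpow_add ht0]
          congr 3
          ring

/-- **The high part of a weak-`L^p` function is integrable for `1 < p`** (the case `r = 1` of
`MemWeakLp.memLp_indicator_one_lt_norm`). [folklore] -/
theorem MemWeakLp.integrable_indicator_one_lt_norm (hf : MemWeakLp f p μ)
    (hfm : StronglyMeasurable f) (hp : p ≠ ∞) (h1p : 1 < p) :
    Integrable ({x | 1 < ‖f x‖}.indicator f) μ :=
  memLp_one_iff_integrable.1 (hf.memLp_indicator_one_lt_norm hfm hp one_ne_zero h1p)

/-! ### The low part `f 𝟙_{‖f‖ ≤ 1}` -/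

omit [MeasurableSpace α] in
/-- The low part is bounded by `1`. [folklore] -/
theorem norm_indicator_norm_le_one_le (f : α → E) (x : α) :
    ‖{x | ‖f x‖ ≤ 1}.indicator f x‖ ≤ 1 := by
  by_cases hx : x ∈ {x | ‖f x‖ ≤ 1}
  · rw [indicator_of_mem hx]; exact hx
  · rw [indicator_of_notMem hx, norm_zero]; exact zero_le_one

omit [MeasurableSpace α] in
/-- The two truncations recompose `f`: `f 𝟙_{‖f‖>1} + f 𝟙_{‖f‖≤1} = f`. [folklore] -/
theorem indicator_one_lt_norm_add_indicator_norm_le_one (f : α → E) :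
    {x | 1 < ‖f x‖}.indicator f + {x | ‖f x‖ ≤ 1}.indicator f = f := by
  have h : {x | ‖f x‖ ≤ 1} = {x | 1 < ‖f x‖}ᶜ := by
    ext x; simp
  rw [h]
  exact indicator_self_add_compl _ _

/-- **The low part of a weak-`L^p` function is in `L^q` for `p < q < ∞`**: for `f ∈ L^{p,∞}(μ)`
strongly measurable, `p < q < ∞`, the truncation `f 𝟙_{‖f‖ ≤ 1}` lies in `L^q(μ)` (Grafakos,
proof of Thm 1.3.2: the piece `f₁ = f 𝟙_{|f| ≤ α}` is in the larger Lebesgue space; layer cake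
`∫|f𝟙_{Aᶜ}|^q ≤ q∫₀¹ s^{q−1−p}‖f‖^p_{p,∞}`, the superlevel sets at heights `s ≥ 1` being empty). [folklore] -/
theorem MemWeakLp.memLp_indicator_norm_le_one (hf : MemWeakLp f p μ) (hfm : StronglyMeasurable f)
    {q : ℝ≥0∞} (hpq : p < q) (hq : q ≠ ∞) :
    MemLp ({x | ‖f x‖ ≤ 1}.indicator f) q μ := by
  have hp : p ≠ ∞ := (hpq.trans_le le_top).ne
  have hq0 : q ≠ 0 := (lt_of_le_of_lt bot_le hpq).ne'
  have hqpos : 0 < q.toReal := ENNReal.toReal_pos hq0 hq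
  have hpq' : p.toReal < q.toReal := (ENNReal.toReal_lt_toReal hp hq).2 hpq
  have hB : MeasurableSet {x | ‖f x‖ ≤ 1} :=
    measurableSet_le hfm.norm.measurable measurable_const
  set h : α → E := {x | ‖f x‖ ≤ 1}.indicator f with hh
  set W : ℝ≥0∞ := eWeakLpPow f p μ with hW
  have hWtop : W ≠ ∞ := hf.2.ne
  have hhm : AEStronglyMeasurable h μ := hf.1.indicator hB
  refine ⟨hhm, ?_⟩
  rw [eLpNorm_lt_top_iff_lintegral_rpow_enorm_lt_top hq0 hq]
  have hmeas : AEMeasurable (fun x => ‖h x‖) μ := hhm.norm.aemeasurable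
  have hnn : 0 ≤ᵐ[μ] fun x => ‖h x‖ := Eventually.of_forall fun x => norm_nonneg _
  have hlhs : ∫⁻ x, ‖h x‖ₑ ^ q.toReal ∂μ = ∫⁻ x, ENNReal.ofReal (‖h x‖ ^ q.toReal) ∂μ :=
    lintegral_congr fun x => by
      rw [← ofReal_norm, ENNReal.ofReal_rpow_of_nonneg (norm_nonneg _) hqpos.le]
  rw [hlhs, lintegral_rpow_eq_lintegral_meas_lt_mul μ hnn hmeas hqpos]
  refine ENNReal.mul_lt_top ENNReal.ofReal_lt_top ?_
  refine lintegral_Ioi_meas_mul_lt_top_of_le (C₁ := W) (C₂ := 0) hWtop ENNReal.zero_ne_top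
    (a := q.toReal - 1 - p.toReal) (b := -2) (by linarith) (by norm_num) ?_
  intro t ht
  have ht0 : 0 < t := ht
  rcases le_or_gt t 1 with h1 | h1
  · rw [indicator_of_mem (mem_Ioc.2 ⟨ht0, h1⟩)]
    refine le_add_right ?_
    have hsubf : {a | t < ‖h a‖} ⊆ {x | t < ‖f x‖} := by
      intro x hx
      rw [mem_setOf_eq] at hx ⊢
      by_cases hxB : x ∈ {x | ‖f x‖ ≤ 1}
      · rwa [hh, indicator_of_mem hxB] at hx
      · rw [hh, indicator_of_notMem hxB, norm_zero] at hx
        exact absurd hx (not_lt.2 ht0.le)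
    have h2 : μ {a | t < ‖h a‖} ≤ W * (ENNReal.ofReal (t ^ p.toReal))⁻¹ :=
      (measure_mono hsubf).trans (meas_lt_norm_le_eWeakLpPow_mul_inv f p μ ht0)
    calc μ {a | t < ‖h a‖} * ENNReal.ofReal (t ^ (q.toReal - 1))
        ≤ W * (ENNReal.ofReal (t ^ p.toReal))⁻¹ * ENNReal.ofReal (t ^ (q.toReal - 1)) :=
          mul_le_mul' h2 le_rfl
      _ = W * ENNReal.ofReal (t ^ (q.toReal - 1 - p.toReal)) := by
          rw [mul_assoc, ← ENNReal.ofReal_inv_of_pos (Real.rpow_pos_of_pos ht0 _),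
            ← Real.rpow_neg ht0.le, ← ENNReal.ofReal_mul (Real.rpow_nonneg ht0.le _),
            ← Real.rpow_add ht0]
          congr 3
          ring
  · -- above height `1` the superlevel sets of `h` are empty
    have hempty : {a | t < ‖h a‖} = ∅ := by
      refine eq_empty_of_forall_notMem fun x hx => ?_
      rw [mem_setOf_eq] at hx
      exact absurd (hx.trans_le' h1.le) (not_lt.2 (norm_indicator_norm_le_one_le f x))
    rw [hempty, measure_empty, zero_mul]
    exact bot_le

end Literature.Analysis.FunctionSpaces

end
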